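import Summits.QuantumFields.YangMills.Theses.ConvexGribovBody
import Literature.MathematicalPhysics.QuantumFieldTheory.LatticeGaugeProofs
import Literature.MathematicalPhysics.QuantumFieldTheory.LatticeGaugeStaticPotentialProofs
import Literature.RepresentationTheory.CompactGroups.UnitaryTrick

/-!
# Axis-swap invariance of Wilson's torus measure
(crux `ConvexGribovBody.PoincareToGap`, line `Sketch`, stub F2)

HYPERCUBIC SYMMETRY of Wilson's lattice gauge measure on the torus `(ℤ/L)^d`: for a compact group `G`
with a faithful continuous unitary matrix representation `r`, every real `β` and two coordinate axes
`i, j : Fin d`, the push-forward of `wilsonMeasure r.ρ β` under the relabelling of the positively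
oriented edges
`U ↦ ((x, k) ↦ U (x ∘ swap_{ij}, swap_{ij} k))`
is again `wilsonMeasure r.ρ β`.

Proof.  The tree already contains the invariance of Wilson's torus measure under an arbitrary
permutation `π` of the coordinate axes,
`Literature.MathematicalPhysics.QuantumFieldTheory.wilsonMeasure_map_configPerm`
(file `LatticeGaugeStaticPotentialProofs`, §(B)): the configuration map
`configPerm π = MeasurableEquiv.arrowCongr' (edgePerm π) (MeasurableEquiv.refl G)`,
`(configPerm π U) (x, k) = U (sitePerm π⁻¹ x, π⁻¹ k)` with `sitePerm π x = x ∘ π⁻¹`, preserves the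
product Haar measure (`measurePreserving_arrowCongr'`) and the Wilson action (re-indexing of the
plaquettes; the reversed plaquettes have inverse holonomy and `Re tr ρ(g⁻¹) = Re tr ρ(g)` for a
continuous representation of a compact group, `CompactGroup.re_trace_map_inv`).  Since the
transposition `swap_{ij}` is its own inverse, the map of the statement is literally
`⇑(configPerm (Equiv.swap i j))` (`configPerm_apply`, `Equiv.symm_swap`), and the claim is the case
`π = Equiv.swap i j` of the tree theorem.

References: K. Wilson, Phys. Rev. D 10 (1974) 2445; E. Seiler, LNP 159 (1982), Ch. 1 (the Wilson
action and the product Haar measure are invariant under the full hypercubic group). [folklore]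
-/

noncomputable section

open scoped BigOperators Topology
open MeasureTheory Filter
open Literature.MathematicalPhysics.QuantumFieldTheory

namespace Summit.QuantumFields.YangMills.Theorems.PoincareToGap

/-- The axis-swap relabelling of torus gauge configurations of the statement of
`stub_wilsonMeasure_map_axisSwap`, `U ↦ ((x, k) ↦ U (x ∘ swap_{ij}, swap_{ij} k))`, is the tree's
coordinate permutation `configPerm (Equiv.swap i j)` (a transposition is its own inverse). [folklore] -/
theorem axisSwap_eq_coe_configPerm {G : Type*} [MeasurableSpace G] {d L : ℕ} (i j : Fin d) :
    (fun (U : GaugeConfig d L G) (e : Edge d L) =>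
        U (fun k => e.1 (Equiv.swap i j k), Equiv.swap i j e.2)) =
      ⇑(configPerm (G := G) (L := L) (Equiv.swap i j)) := by
  funext U e
  exact (configPerm_apply (Equiv.swap i j) U e).symm

/-- **F2: hypercubic symmetry — Wilson's torus measure is invariant under the exchange of two
coordinate axes.**  For every `d`, `L ≥ 1`, every compact group `G` with lattice representation data
`r`, every real `β` and axes `i, j : Fin d`, the push-forward of `wilsonMeasure r.ρ β` under
`U ↦ ((x, k) ↦ U (x ∘ swap_{ij}, swap_{ij} k))` is `wilsonMeasure r.ρ β`.  This is the case
`π = Equiv.swap i j` of the tree's `wilsonMeasure_map_configPerm`. [folklore] -/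
theorem stub_wilsonMeasure_map_axisSwap :
    ∀ (G : Type) [Group G] [TopologicalSpace G] [IsTopologicalGroup G] [CompactSpace G]
      [MeasurableSpace G] [BorelSpace G] (r : LatticeRep G) (β : ℝ) (d L : ℕ) [NeZero L] (i j : Fin d),
    (wilsonMeasure r.ρ β : Measure (GaugeConfig d L G)).map
        (fun (U : GaugeConfig d L G) (e : Edge d L) =>
          U (fun k => e.1 (Equiv.swap i j k), Equiv.swap i j e.2)) =
      (wilsonMeasure r.ρ β : Measure (GaugeConfig d L G)) := by
  intro G _ _ _ _ _ _ r β d L _ i j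
  rw [axisSwap_eq_coe_configPerm (G := G) (L := L) i j]
  exact wilsonMeasure_map_configPerm r.ρ r.continuous β (Equiv.swap i j)

end Summit.QuantumFields.YangMills.Theorems.PoincareToGap

end
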